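import Summits.NavierStokesRegularity.NavierStokesRegularity.Theorems.RungBlowupCofinal.PureWaveExclusion
import Summits.NavierStokesRegularity.FluidComputer.AngularGalerkinLadderStructure
import HarnessLib

/-!
# THE BAND-VISIBLE SELF-ADVECTION IS LOAD-BEARING: a Type-I ancient band-limited classical
# solution whose force minus self-advection is invisible to the rung (co-band-limited modulo a
# gradient at every time) is trivial (route `AngularGalerkinLadder`, cruxes K1 `RungBlowupCofinal`
# / K2 `NoOverheating`; helper, theorems only)

Cell `ns-blowup`, seat `ns-blowup-circuit` (g12, AGL Lean seat). Helper file for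
`stmt-NavierStokesRegularity-19959` (K1 of route №8); the physical-variables, time-dependent
companion of `PureWaveExclusion.lean` (card (S4) of the line `Cruxes/RungBlowupCofinal/Lines/qlwave.lean`).

## Statement (`eq_zero_of_force_sub_convect_coband`)

Let `(u, p)` be a classical solution on `(−∞, 0)` of the Navier–Stokes system forced by `f`
(`IsClassicalNSSolutionOn (Iio 0) 1 f u p`), with band-limited velocity slices
(`IsBandLimited L (u t)`) and the Type-I bound `‖u(t, x)‖ ≤ C₀/(‖x‖ + √(−t))`. Suppose that at
every time `t < 0` the field `f(t) − (u(t)·∇)u(t)` is co-band-limited modulo a smooth gradient.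
Then `u ≡ 0`. Two readings:

* **linear rung system** (`eq_zero_of_linearRung`): `f = (u·∇)u + e` with `e(t)` co-band-limited —
  i.e. `(u, p)` solves the LINEAR system `∂ₜu = Δu − ∇p + e`, `div u = 0`, band-limited velocity,
  co-band defect: the linearisation AT ZERO of the full rung dynamics `NS_L`, for arbitrary time
  dependence (steady, precessing, DSS, chaotic). It has no non-trivial Type-I ancient solution:
  no small-amplitude ancient rung dynamics bifurcates from rest;
* **rung solutions with rung-invisible nonlinearity** (`eq_zero_of_convect_coband`): `f = d` the
  co-band Galerkin defect of a rung solution (`IsRungSolutionOn (Iio 0) 1 L u p d`) and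
  `(u·∇)u + ∇q_t` co-band for smooth `q_t` — every non-trivial Type-I ancient rung solution, in
  particular every witness of `RungIsSingular L` (K1) and every window profile (K2), has at some
  time a self-advection whose band part is NOT a gradient (`exists_time_convect_not_coband`,
  `rungProfile_exists_time_convect_not_coband`).

## Proof

`B_t = (u·∇)u + ∇p − f = Δu − ∂ₜu` is band-limited (tree: the Laplacian and the time derivative
keep the band); by hypothesis `B_t + ∇(−q_t − p) = −X_t` is co-band-limited; so `curl B_t = 0`
(`BandLimitedCurl.curl_eq_zero_of_add_gradient_eq_coband`), `B_t` is a smooth gradient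
(`PureWaveExclusion.exists_smooth_gradient_eq`) and pairs to zero with solenoidal tests, the tree's
pressure reconstruction (`exists_isClassicalNSSolutionOn_of_forall_integral_inner_eq_zero`, force
`(u·∇)u`) makes `u` a classical STOKES solution, and `AncientStokesLiouville.eq_zero_of_classicalStokes_typeI`
(KNSS Lemma 3.1 by duality) gives `u ≡ 0`.

LABEL: KERNEL (MODEL `NS_L`). Nothing here asserts a Theses declaration; no definition, no named
fact, no sorry. WHAT THIS IS NOT: not Navier–Stokes evidence — statements about ancient
solutions of the truncated MODEL `NS_L` and of its linearisation; they exclude degenerate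
sub-classes of candidate profiles and construct none. References: [cite:
KochNadirashviliSereginSverak2009, Lemma 3.1 (arXiv:0709.3599v1 p. 7)]; [cite: BullardGellman1954].
-/

noncomputable section

namespace Summit.NavierStokesRegularity.AngularGalerkinLadderNonlinearityLoadBearing

open Set Function MeasureTheory Filter Topology InnerProductSpace
open scoped RealInnerProductSpace Laplacian ContDiff
open Literature.Analysis.FluidPDE Literature.Analysis
open Summit.NavierStokesRegularity.FluidComputer
open Summit.NavierStokesRegularity.FluidComputer.AngularLadder
open Summit.NavierStokesRegularity.AngularGalerkinLadderBandLimitedCurl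
open Summit.NavierStokesRegularity.AngularGalerkinLadderAncientStokesLiouville
open Summit.NavierStokesRegularity.AngularGalerkinLadderPureWaveExclusion

variable {L : ℕ} {C₀ : ℝ}
  {u f d : ℝ → EuclideanSpace ℝ (Fin 3) → EuclideanSpace ℝ (Fin 3)}
  {p : ℝ → EuclideanSpace ℝ (Fin 3) → ℝ}

/-- The gradient of a difference of differentiable functions. [folklore] -/
private theorem gradient_sub' {g g' : EuclideanSpace ℝ (Fin 3) → ℝ} {x : EuclideanSpace ℝ (Fin 3)}
    (hg : DifferentiableAt ℝ g x) (hg' : DifferentiableAt ℝ g' x) :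
    gradient (fun y => g y - g' y) x = gradient g x - gradient g' x := by
  simp only [gradient, fderiv_fun_sub hg hg', map_sub]

/-- The gradient of a negative. [folklore] -/
private theorem gradient_neg' (g : EuclideanSpace ℝ (Fin 3) → ℝ) (x : EuclideanSpace ℝ (Fin 3)) :
    gradient (fun y => -g y) x = -gradient g x := by
  simp only [gradient, fderiv_fun_neg, map_neg]

/-! ## §1 The momentum residual of a band-limited classical solution -/

/-- **The residual `(u·∇)u + ∇p − f = Δu − ∂ₜu` of a classical solution with band-limited
velocity slices is band-limited** (on a time set of unique differentiability): the Laplacian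
and the time derivative keep the band (tree `IsBandLimited.laplacian`,
`isBandLimited_timeDerivWithin`). [cite: BullardGellman1954] -/
theorem isBandLimited_residual {S : Set ℝ} (h : IsClassicalNSSolutionOn S 1 f u p)
    (hS : UniqueDiffOn ℝ S) (hband : ∀ t ∈ S, IsBandLimited L (u t)) {t : ℝ} (ht : t ∈ S) :
    IsBandLimited L fun x => convect (u t) (u t) x + gradient (p t) x - f t x := by
  have e : (fun x => convect (u t) (u t) x + gradient (p t) x - f t x) =
      (fun x => (1 : ℝ) • Δ (u t) x) - timeDerivWithin S u t := by
    funext x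
    have hm := h.momentum t ht x
    show _ = (1 : ℝ) • Δ (u t) x - timeDerivWithin S u t x
    calc convect (u t) (u t) x + gradient (p t) x - f t x
        = (timeDerivWithin S u t x + convect (u t) (u t) x) -
            timeDerivWithin S u t x + gradient (p t) x - f t x := by abel
      _ = ((1 : ℝ) • Δ (u t) x - gradient (p t) x + f t x) -
            timeDerivWithin S u t x + gradient (p t) x - f t x := by rw [hm]
      _ = (1 : ℝ) • Δ (u t) x - timeDerivWithin S u t x := by abel
  rw [e]
  exact ((hband t ht).viscous 1).sub
    (AngularLadder.isBandLimited_timeDerivWithin h.smooth_velocity hS hband ht)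

/-- **Force minus self-advection co-band modulo a gradient ⟹ the residual is curl-free.**
[cite: BullardGellman1954] -/
theorem curl_residual_eq_zero {S : Set ℝ} (h : IsClassicalNSSolutionOn S 1 f u p)
    (hS : UniqueDiffOn ℝ S) (hband : ∀ t ∈ S, IsBandLimited L (u t)) {t : ℝ} (ht : t ∈ S)
    {q : EuclideanSpace ℝ (Fin 3) → ℝ} (hq : ContDiff ℝ ∞ q)
    (hX : IsCobandLimited L fun x => f t x - convect (u t) (u t) x + gradient q x) :
    curl (fun x => convect (u t) (u t) x + gradient (p t) x - f t x) = 0 := by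
  have hB := isBandLimited_residual h hS hband ht
  have hpt : ContDiff ℝ ∞ (p t) := h.contDiff_pressure ht
  -- `B_t + ∇(−q − p t) = −X_t`
  refine curl_eq_zero_of_add_gradient_eq_coband hB (hq.neg.sub hpt) hX.neg fun y => ?_
  have hqd : DifferentiableAt ℝ (fun z => -q z) y := ((hq.differentiable (by simp)) y).neg
  have hpd : DifferentiableAt ℝ (p t) y := (hpt.differentiable (by simp)) y
  rw [gradient_sub' hqd hpd, gradient_neg']
  simp only [Pi.neg_apply]
  abel

/-! ## §2 The Liouville theorem -/

/-- **THE BAND-VISIBLE SELF-ADVECTION IS LOAD-BEARING (general form).** Let `(u, p)` be a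
classical solution on `(−∞, 0)` of Navier–Stokes forced by `f`, with band-limited velocity slices
and the Type-I bound `‖u(t,x)‖ ≤ C₀/(‖x‖ + √−t)`. If at every `t < 0` there is a smooth `q_t`
with `f(t) − (u(t)·∇)u(t) + ∇q_t` co-band-limited of degree `≤ L`, then `u ≡ 0`: the residual
`(u·∇)u + ∇p − f` is a curl-free band-limited field, hence a gradient, so `u` solves the
homogeneous Stokes system classically (pressure reconstructed by the tree's
`exists_isClassicalNSSolutionOn_of_forall_integral_inner_eq_zero` with force `(u·∇)u`), and the
ancient Stokes Liouville theorem with Type-I decay applies.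
[cite: KochNadirashviliSereginSverak2009, Lemma 3.1 (arXiv:0709.3599v1 p. 7)] -/
theorem eq_zero_of_force_sub_convect_coband (h : IsClassicalNSSolutionOn (Iio 0) 1 f u p)
    (hband : ∀ t < 0, IsBandLimited L (u t))
    (hdec : ∀ t < 0, ∀ x, ‖u t x‖ ≤ C₀ / (‖x‖ + Real.sqrt (-t)))
    (hinv : ∀ t < 0, ∃ q : EuclideanSpace ℝ (Fin 3) → ℝ, ContDiff ℝ ∞ q ∧
      IsCobandLimited L fun x => f t x - convect (u t) (u t) x + gradient q x) :
    ∀ t < 0, ∀ x, u t x = 0 := by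
  have hS : UniqueDiffOn ℝ (Iio (0 : ℝ)) := uniqueDiffOn_Iio 0
  have hu : IsSmoothSpaceTimeOn (Iio 0) u := h.smooth_velocity
  -- the force `(u·∇)u` is jointly smooth
  have hF : IsSmoothSpaceTimeOn (Iio 0) (fun t x => convect (u t) (u t) x) := hu.convect hu hS
  -- the Stokes residual `∂ₜu − Δu = −B_t` pairs to zero with solenoidal tests
  have horth : ∀ t ∈ Iio (0 : ℝ), ∀ φ : EuclideanSpace ℝ (Fin 3) → EuclideanSpace ℝ (Fin 3),
      FunctionSpaces.IsTestFunctionOn (⊤ : TopologicalSpace.Opens (EuclideanSpace ℝ (Fin 3))) φ →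
      VectorCalculus.IsDivFree φ →
        ∫ x, ⟪timeDerivWithin (Iio 0) u t x + convect (u t) (u t) x - (1 : ℝ) • (Δ (u t)) x -
          (fun t x => convect (u t) (u t) x) t x, φ x⟫ = 0 := by
    intro t ht φ hφ hφdiv
    obtain ⟨q, hq, hX⟩ := hinv t ht
    -- the residual `B_t` is a smooth gradient
    set B : EuclideanSpace ℝ (Fin 3) → EuclideanSpace ℝ (Fin 3) :=
      fun x => convect (u t) (u t) x + gradient (p t) x - f t x with hB
    have hBband : IsBandLimited L B := isBandLimited_residual h hS (fun s hs => hband s hs) ht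
    have hBcurl : curl B = 0 := curl_residual_eq_zero h hS (fun s hs => hband s hs) ht hq hX
    obtain ⟨g, hg, hgrad⟩ := exists_smooth_gradient_eq hBband.1 hBcurl
    -- the integrand is `−⟪B, φ⟫ = −⟪∇g, φ⟫`
    have hmom : ∀ x, timeDerivWithin (Iio 0) u t x + convect (u t) (u t) x -
        (1 : ℝ) • (Δ (u t)) x - (fun t x => convect (u t) (u t) x) t x = -gradient g x := by
      intro x
      have hm := h.momentum t ht x
      rw [hgrad x]
      simp only [hB]
      rw [hm]
      abel
    have hg1 : ContDiff ℝ 1 g := contDiff_infty.1 hg 1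
    have hφ1 : ContDiff ℝ 1 φ := contDiff_infty.1 hφ.contDiff 1
    simp_rw [hmom, inner_neg_left, integral_neg,
      integral_inner_gradient_eq_neg_integral_mul_divergence hg1 hφ1 hφ.hasCompactSupport]
    simp [hφdiv _]
  obtain ⟨p', hcl'⟩ := exists_isClassicalNSSolutionOn_of_forall_integral_inner_eq_zero
    isOpen_Iio hu hF (fun t ht => h.divFree t ht) horth
  exact eq_zero_of_classicalStokes_typeI hcl' (fun t _ x => rfl) hdec

/-! ## §3 Reading one: the LINEAR rung system has no Type-I ancient solutions -/

/-- **The linearisation at rest of the rung dynamics has no non-trivial Type-I ancient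
solution.** Let `(u, p)` solve classically on `(−∞, 0)` the LINEAR system
`∂ₜu = Δu − ∇p + e`, `div u = 0` (rendered as forced Navier–Stokes with force `(u·∇)u + e`), with
band-limited velocity slices, a co-band-limited defect `e(t)` at every time, and a Type-I bound.
Then `u ≡ 0` — for ARBITRARY time dependence (steady, precessing, discretely self-similar, …): no
ancient rung dynamics bifurcates from `u = 0`. [cite: KochNadirashviliSereginSverak2009, Lemma 3.1 (arXiv:0709.3599v1 p. 7)] -/
theorem eq_zero_of_linearRung {e : ℝ → EuclideanSpace ℝ (Fin 3) → EuclideanSpace ℝ (Fin 3)}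
    (h : IsClassicalNSSolutionOn (Iio 0) 1 (fun t x => convect (u t) (u t) x + e t x) u p)
    (hband : ∀ t < 0, IsBandLimited L (u t)) (he : ∀ t < 0, IsCobandLimited L (e t))
    (hdec : ∀ t < 0, ∀ x, ‖u t x‖ ≤ C₀ / (‖x‖ + Real.sqrt (-t))) :
    ∀ t < 0, ∀ x, u t x = 0 := by
  refine eq_zero_of_force_sub_convect_coband h hband hdec fun t ht =>
    ⟨fun _ => 0, contDiff_const, ?_⟩
  have e0 : (fun x => (fun t x => convect (u t) (u t) x + e t x) t x - convect (u t) (u t) x +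
      gradient (fun _ : EuclideanSpace ℝ (Fin 3) => (0 : ℝ)) x) = e t := by
    funext x
    have h0 : gradient (fun _ : EuclideanSpace ℝ (Fin 3) => (0 : ℝ)) x = 0 := by
      simp [gradient]
    rw [h0]
    simp
  rw [e0]
  exact he t ht

/-! ## §4 Reading two: rung solutions with rung-invisible nonlinearity are trivial -/

/-- **A Type-I ancient rung solution whose self-advection is co-band-limited modulo a gradient
at every time is trivial.** [cite: KochNadirashviliSereginSverak2009, Lemma 3.1 (arXiv:0709.3599v1 p. 7)] -/
theorem eq_zero_of_convect_coband (h : IsRungSolutionOn (Iio 0) 1 L u p d)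
    (hdec : ∀ t < 0, ∀ x, ‖u t x‖ ≤ C₀ / (‖x‖ + Real.sqrt (-t)))
    (hinv : ∀ t < 0, ∃ q : EuclideanSpace ℝ (Fin 3) → ℝ, ContDiff ℝ ∞ q ∧
      IsCobandLimited L fun x => convect (u t) (u t) x + gradient q x) :
    ∀ t < 0, ∀ x, u t x = 0 := by
  have hS : UniqueDiffOn ℝ (Iio (0 : ℝ)) := uniqueDiffOn_Iio 0
  refine eq_zero_of_force_sub_convect_coband h.1 h.2.1 hdec fun t ht => ?_
  obtain ⟨q, hq, hX⟩ := hinv t ht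
  have hut : ContDiff ℝ ∞ (u t) := h.1.contDiff_velocity ht
  have hdc : Continuous (d t) := h.1.continuous_force_slice hS ht
  -- `X_t = (u·∇)u + ∇q` is continuous
  have hgq : ContDiff ℝ ∞ (gradient q) := by
    have e : gradient q = fun y =>
        (InnerProductSpace.toDual ℝ (EuclideanSpace ℝ (Fin 3))).symm (fderiv ℝ q y) := rfl
    rw [e]
    exact (InnerProductSpace.toDual ℝ (EuclideanSpace ℝ (Fin 3))).symm.contDiff.comp
      ((contDiff_infty_iff_fderiv.1 hq).2)
  have hconv : ContDiff ℝ ∞ (fun x => convect (u t) (u t) x) := by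
    have e : (fun x => convect (u t) (u t) x) = fun x => fderiv ℝ (u t) x (u t x) := rfl
    rw [e]
    exact ((contDiff_infty_iff_fderiv.1 hut).2).clm_apply hut
  have hXc : Continuous (fun x => convect (u t) (u t) x + gradient q x) :=
    (hconv.add hgq).continuous
  -- with `q' = −q`: `d − (u·∇)u + ∇(−q) = d − X_t`
  refine ⟨fun y => -q y, hq.neg, ?_⟩
  have e1 : (fun x => d t x - convect (u t) (u t) x + gradient (fun y => -q y) x) =
      d t + -(fun x => convect (u t) (u t) x + gradient q x) := by
    funext x
    rw [gradient_neg']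
    simp only [Pi.add_apply, Pi.neg_apply]
    abel
  rw [e1]
  exact (h.2.2 t ht).add hX.neg hdc hXc.neg

/-- **Every non-trivial Type-I ancient rung solution has band-VISIBLE self-advection at some
time**: at some `t < 0` NO smooth scalar `q` makes `(u(t)·∇)u(t) + ∇q` co-band-limited.
[folklore] -/
theorem exists_time_convect_not_coband (h : IsRungSolutionOn (Iio 0) 1 L u p d)
    (hdec : ∀ t < 0, ∀ x, ‖u t x‖ ≤ C₀ / (‖x‖ + Real.sqrt (-t)))
    (hne : ∃ t < 0, ∃ x, u t x ≠ 0) :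
    ∃ t < 0, ∀ q : EuclideanSpace ℝ (Fin 3) → ℝ, ContDiff ℝ ∞ q →
      ¬ IsCobandLimited L (fun x => convect (u t) (u t) x + gradient q x) := by
  by_contra hall
  push Not at hall
  obtain ⟨t, ht, x, hx⟩ := hne
  exact hx (eq_zero_of_convect_coband h hdec (fun s hs => hall s hs) t ht x)

/-- **The same for the witnesses of `RungIsSingular L` (crux K1) and the window profiles of K2**:
a non-trivial Type-I rotated-DSS ancient rung profile (`IsRungProfile L C₀ c R u p d`) has, at some
time, a self-advection whose band part is not a gradient. [folklore] -/
theorem rungProfile_exists_time_convect_not_coband {c : ℝ}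
    {R : EuclideanSpace ℝ (Fin 3) ≃ₗᵢ[ℝ] EuclideanSpace ℝ (Fin 3)}
    (h : IsRungProfile L C₀ c R u p d) (hne : ∃ t < 0, ∃ x, u t x ≠ 0) :
    ∃ t < 0, ∀ q : EuclideanSpace ℝ (Fin 3) → ℝ, ContDiff ℝ ∞ q →
      ¬ IsCobandLimited L (fun x => convect (u t) (u t) x + gradient q x) :=
  exists_time_convect_not_coband h.1 h.hasTypeIDecay hne

/-- **Rung-invisible nonlinearity never produces a singular rung**: a rung profile whose
self-advection is, at every time, co-band-limited modulo a gradient is trivial (so it is no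
witness of `RungIsSingular L`). [folklore] -/
theorem rungProfile_eq_zero_of_convect_coband {c : ℝ}
    {R : EuclideanSpace ℝ (Fin 3) ≃ₗᵢ[ℝ] EuclideanSpace ℝ (Fin 3)}
    (h : IsRungProfile L C₀ c R u p d)
    (hinv : ∀ t < 0, ∃ q : EuclideanSpace ℝ (Fin 3) → ℝ, ContDiff ℝ ∞ q ∧
      IsCobandLimited L fun x => convect (u t) (u t) x + gradient q x) :
    ∀ t < 0, ∀ x, u t x = 0 :=
  eq_zero_of_convect_coband h.1 h.hasTypeIDecay hinv

end Summit.NavierStokesRegularity.AngularGalerkinLadderNonlinearityLoadBearing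

end
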